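import Summits.SmoothPoincare4.SmoothPoincare4.Theorems.SullivanDualWitnessChargeHelperEndHolomorphic
import Summits.SmoothPoincare4.SmoothPoincare4.Theorems.SullivanDualWitnessChargeDefs
import Summits.SmoothPoincare4.SmoothPoincare4.Theorems.SullivanDualTameOrBrodyR4StubExteriorSchwarz
import Mathlib.Analysis.Complex.Basic

/-!
# Helper `helper_memberFarDecay_of` of line `Sketch` for crux `WitnessCharge`
(item stmt-SmoothPoincare4-7824; route `SullivanDual`, crux
`Summit.SmoothPoincare4.SmoothPoincare4.Theses.SullivanDual.WitnessCharge`; line `Sketch`,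
registered stub `helper_memberFarDecay_of` of the lead's cycle-2 helper skeleton, wave 2 —
(N)-branch uniform control)

**Uniform decay of the normalisation defect of a pencil member.** Let `J` be STANDARD on the
punctured `ε'`-chart-ball `B_{ε'}` at `p` (closed `ε'`-ball inside the chart target) and let
`u : ℂ → Σ∖p` be a pencil member of intercept `b` (`IsPencilMember J u b`). Write
`φ ξ = (Ycoord p (u ξ)).1` and `f ξ = φ ξ − ξ` (so `f → 0` at infinity by the member axiom).
Assume, for every `R > ε'⁻¹`, the two pieces of uniform control supplied by the neighbouring
helpers of the skeleton:

* COVERS: `2R < ‖ξ‖ ⟹ u ξ ∈ B_{ε'} ∧ R < ‖φ ξ‖`;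
* NEAR: for `r ≥ 2R`, `‖ξ‖ ≤ r ∧ u ξ ∈ B_{ε'} ⟹ ‖φ ξ‖ ≤ 2r`.

Then for every `R > ε'⁻¹` and `‖ξ‖ ≥ 4R`:

  `‖φ ξ − ξ‖ ≤ 48 R² / ‖ξ‖`.

Proof. The Schwarz lemma at infinity (`stub_exteriorSchwarz`, landed for crux `TameOrBrodyR4`)
with `R₁ = 2R`, `R₂ = 4R`, `L = 12R`:
* `f` is holomorphic on `{2R < ‖c‖}`: this set lies in `u⁻¹(B_{ε'})` by COVERS, where `Ycoord ∘ u`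
  is holomorphic (`helper_endHolomorphic`, E0); take the first component and subtract the identity;
* `f` is bounded on `{2R < ‖c‖}`: `‖f‖ < 1` off a compact set `K ⊆ closedBall 0 r₁` (member axiom),
  and on `{2R < ‖c‖ ≤ r₁}` NEAR with `r = max r₁ (2R)` gives `‖φ c‖ ≤ 2r`, so `‖f c‖ ≤ 3r`;
* `f → 0` at infinity (member axiom);
* on the circle `‖c‖ = 4R`: `u c ∈ B_{ε'}` by COVERS and NEAR with `r = 4R` gives `‖φ c‖ ≤ 8R`, so
  `‖f c‖ ≤ 12R`.
Hence `‖f ξ‖ ≤ 12R · 4R / ‖ξ‖ = 48R²/‖ξ‖` for `‖ξ‖ ≥ 4R`.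
-/

noncomputable section

-- the registered namespace `Summit.SmoothPoincare4.SmoothPoincare4.…` repeats a component
set_option linter.dupNamespace false

open scoped Manifold ContDiff Topology
open Set Filter Literature.Geometry.Kaehler Literature.Geometry.Symplectic
  Literature.Topology.FourManifolds

namespace Summit.SmoothPoincare4.SmoothPoincare4.Theorems.WitnessCharge.PencilIncompleteness

/-- **Uniform far decay of the normalisation defect (N-branch).** Given the covering property
COVERS (`2R < ‖ξ‖ ⟹ u ξ ∈ B_{ε'} ∧ R < ‖φ ξ‖`) and the near bound NEAR
(`r ≥ 2R`, `‖ξ‖ ≤ r`, `u ξ ∈ B_{ε'} ⟹ ‖φ ξ‖ ≤ 2r`) for pencil members with `J` standard on the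
punctured `ε'`-chart-ball, every pencil member `u` of intercept `b` satisfies, for `R > ε'⁻¹` and
`‖ξ‖ ≥ 4R`, the uniform decay `‖(Ycoord p (u ξ)).1 − ξ‖ ≤ 48 R² / ‖ξ‖` (Schwarz lemma at infinity
applied to `f = φ − id` on `{2R < ‖c‖}` with the bound `12R` on the circle `‖c‖ = 4R`). -/
theorem helper_memberFarDecay_of :
    (∀ (S : HomotopySphere 4) (p : S.carrier)
      (J : ∀ x : punctured p, TangentSpace (𝓡 4) x →L[ℝ] TangentSpace (𝓡 4) x) (ε' : ℝ)
      (u : ℂ → punctured p) (b : ℂ),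
      0 < ε' →
      Metric.closedBall (extChartAt (𝓡 4) p p) ε' ⊆ (extChartAt (𝓡 4) p).target →
      (∀ x : punctured p, InPuncturedChartBall p ε' x →
        ∀ (v : TangentSpace (𝓡 4) x) (b : EuclideanSpace ℝ (Fin 4)),
          inner ℝ (fderiv ℝ inversion (extChartAt (𝓡 4) p x.1 - extChartAt (𝓡 4) p p)
            (mfderiv (𝓡 4) 𝓘(ℝ, EuclideanSpace ℝ (Fin 4))
              (fun z : punctured p => extChartAt (𝓡 4) p z.1) x (J x v))) b
          = stdSymplecticForm (fderiv ℝ inversion (extChartAt (𝓡 4) p x.1 - extChartAt (𝓡 4) p p)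
            (mfderiv (𝓡 4) 𝓘(ℝ, EuclideanSpace ℝ (Fin 4))
              (fun z : punctured p => extChartAt (𝓡 4) p z.1) x v)) b) →
      IsPencilMember J u b →
      ∀ R : ℝ, ε'⁻¹ < R → ∀ ξ : ℂ, 2 * R < ‖ξ‖ →
        InPuncturedChartBall p ε' (u ξ) ∧ R < ‖(Ycoord p (u ξ)).1‖) →
    (∀ (S : HomotopySphere 4) (p : S.carrier)
      (J : ∀ x : punctured p, TangentSpace (𝓡 4) x →L[ℝ] TangentSpace (𝓡 4) x) (ε' : ℝ)
      (u : ℂ → punctured p) (b : ℂ),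
      0 < ε' →
      Metric.closedBall (extChartAt (𝓡 4) p p) ε' ⊆ (extChartAt (𝓡 4) p).target →
      (∀ x : punctured p, InPuncturedChartBall p ε' x →
        ∀ (v : TangentSpace (𝓡 4) x) (b : EuclideanSpace ℝ (Fin 4)),
          inner ℝ (fderiv ℝ inversion (extChartAt (𝓡 4) p x.1 - extChartAt (𝓡 4) p p)
            (mfderiv (𝓡 4) 𝓘(ℝ, EuclideanSpace ℝ (Fin 4))
              (fun z : punctured p => extChartAt (𝓡 4) p z.1) x (J x v))) b
          = stdSymplecticForm (fderiv ℝ inversion (extChartAt (𝓡 4) p x.1 - extChartAt (𝓡 4) p p)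
            (mfderiv (𝓡 4) 𝓘(ℝ, EuclideanSpace ℝ (Fin 4))
              (fun z : punctured p => extChartAt (𝓡 4) p z.1) x v)) b) →
      IsPencilMember J u b →
      ∀ R : ℝ, ε'⁻¹ < R → ∀ r : ℝ, 2 * R ≤ r → ∀ ξ : ℂ, ‖ξ‖ ≤ r →
        InPuncturedChartBall p ε' (u ξ) → ‖(Ycoord p (u ξ)).1‖ ≤ 2 * r) →
    ∀ (S : HomotopySphere 4) (p : S.carrier)
      (J : ∀ x : punctured p, TangentSpace (𝓡 4) x →L[ℝ] TangentSpace (𝓡 4) x) (ε' : ℝ)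
      (u : ℂ → punctured p) (b : ℂ),
      0 < ε' →
      Metric.closedBall (extChartAt (𝓡 4) p p) ε' ⊆ (extChartAt (𝓡 4) p).target →
      (∀ x : punctured p, InPuncturedChartBall p ε' x →
        ∀ (v : TangentSpace (𝓡 4) x) (b : EuclideanSpace ℝ (Fin 4)),
          inner ℝ (fderiv ℝ inversion (extChartAt (𝓡 4) p x.1 - extChartAt (𝓡 4) p p)
            (mfderiv (𝓡 4) 𝓘(ℝ, EuclideanSpace ℝ (Fin 4))
              (fun z : punctured p => extChartAt (𝓡 4) p z.1) x (J x v))) b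
          = stdSymplecticForm (fderiv ℝ inversion (extChartAt (𝓡 4) p x.1 - extChartAt (𝓡 4) p p)
            (mfderiv (𝓡 4) 𝓘(ℝ, EuclideanSpace ℝ (Fin 4))
              (fun z : punctured p => extChartAt (𝓡 4) p z.1) x v)) b) →
      IsPencilMember J u b →
      ∀ R : ℝ, ε'⁻¹ < R → ∀ ξ : ℂ, 4 * R ≤ ‖ξ‖ →
        ‖(Ycoord p (u ξ)).1 - ξ‖ ≤ 48 * R ^ 2 / ‖ξ‖ := by
  intro hcov hnear S p J ε' u b hε' hball hJstd hmem R hR ξ hξ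
  have hR0 : 0 < R := (inv_pos.2 hε').trans hR
  -- the two pieces of uniform control, specialised to this member and this `R`
  have hcov' : ∀ c : ℂ, 2 * R < ‖c‖ →
      InPuncturedChartBall p ε' (u c) ∧ R < ‖(Ycoord p (u c)).1‖ :=
    hcov S p J ε' u b hε' hball hJstd hmem R hR
  have hnear' : ∀ r : ℝ, 2 * R ≤ r → ∀ c : ℂ, ‖c‖ ≤ r →
      InPuncturedChartBall p ε' (u c) → ‖(Ycoord p (u c)).1‖ ≤ 2 * r :=
    hnear S p J ε' u b hε' hball hJstd hmem R hR
  -- holomorphy of `Ycoord ∘ u` on `u⁻¹(B_{ε'})` (E0)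
  obtain ⟨-, hdiff, -, -⟩ :=
    helper_endHolomorphic S p J ε' hε' hball hJstd u hmem.1.contMDiff hmem.1.isJHolomorphic
  -- the member axiom: `φ ξ − ξ → 0` at infinity
  have hf0 : Tendsto (fun c : ℂ => (Ycoord p (u c)).1 - c) (cocompact ℂ) (𝓝 0) :=
    hmem.2.2.2.2.1
  -- (a) holomorphy of `f = φ − id` on the exterior domain `{2R < ‖c‖} ⊆ u⁻¹(B_{ε'})`
  have hf : DifferentiableOn ℂ (fun c : ℂ => (Ycoord p (u c)).1 - c) {c : ℂ | 2 * R < ‖c‖} := by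
    have h1 : DifferentiableOn ℂ (fun c : ℂ => Ycoord p (u c)) {c : ℂ | 2 * R < ‖c‖} :=
      hdiff.mono fun c hc => (hcov' c hc).1
    exact h1.fst.sub differentiableOn_id
  -- the elementary bound `‖φ c − c‖ ≤ ‖φ c‖ + ‖c‖`
  have htri : ∀ c : ℂ, ‖(Ycoord p (u c)).1 - c‖ ≤ ‖(Ycoord p (u c)).1‖ + ‖c‖ := fun c =>
    norm_sub_le _ _
  -- (b) boundedness of `f` on the exterior domain
  have hfb : ∃ M : ℝ, ∀ c : ℂ, 2 * R < ‖c‖ → ‖(Ycoord p (u c)).1 - c‖ ≤ M := by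
    have hev : ∀ᶠ c in cocompact ℂ, ‖(Ycoord p (u c)).1 - c‖ < 1 := by
      filter_upwards [hf0.eventually (Metric.ball_mem_nhds (0 : ℂ) one_pos)] with c hc
      rwa [dist_zero_right] at hc
    obtain ⟨K, hK, hKsub⟩ := mem_cocompact.1 hev
    obtain ⟨r₁, hr₁⟩ := isBounded_iff_forall_norm_le.1 hK.isBounded
    refine ⟨3 * max r₁ (2 * R) + 1, fun c hc => ?_⟩
    have hrmax : 2 * R ≤ max r₁ (2 * R) := le_max_right _ _
    have hmax0 : 0 ≤ max r₁ (2 * R) := le_trans (by positivity) hrmax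
    by_cases hcr : ‖c‖ ≤ r₁
    · -- inside the disc of radius `r₁`: NEAR with `r = max r₁ (2R)`
      have hφ : ‖(Ycoord p (u c)).1‖ ≤ 2 * max r₁ (2 * R) :=
        hnear' (max r₁ (2 * R)) hrmax c (hcr.trans (le_max_left _ _)) (hcov' c hc).1
      calc ‖(Ycoord p (u c)).1 - c‖ ≤ ‖(Ycoord p (u c)).1‖ + ‖c‖ := htri c
        _ ≤ 2 * max r₁ (2 * R) + max r₁ (2 * R) := add_le_add hφ (hcr.trans (le_max_left _ _))
        _ ≤ 3 * max r₁ (2 * R) + 1 := by linarith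
    · -- outside: `c ∉ K`, so `‖f c‖ < 1`
      have hcK : c ∉ K := fun h => hcr (hr₁ c h)
      have h1 : ‖(Ycoord p (u c)).1 - c‖ < 1 := hKsub hcK
      linarith
  -- (d) the bound `12R` on the circle `‖c‖ = 4R`
  have hfL : ∀ c : ℂ, ‖c‖ = 4 * R → ‖(Ycoord p (u c)).1 - c‖ ≤ 12 * R := by
    intro c hc
    have hc2 : 2 * R < ‖c‖ := by rw [hc]; linarith
    have hφ : ‖(Ycoord p (u c)).1‖ ≤ 2 * (4 * R) :=
      hnear' (4 * R) (by linarith) c hc.le (hcov' c hc2).1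
    calc ‖(Ycoord p (u c)).1 - c‖ ≤ ‖(Ycoord p (u c)).1‖ + ‖c‖ := htri c
      _ ≤ 2 * (4 * R) + 4 * R := add_le_add hφ hc.le
      _ = 12 * R := by ring
  -- the Schwarz lemma at infinity
  have key :=
    Summit.SmoothPoincare4.SmoothPoincare4.Cruxes.TameOrBrodyR4.Sketch.stub_exteriorSchwarz
      (fun c : ℂ => (Ycoord p (u c)).1 - c) (2 * R) (4 * R) (12 * R) (by positivity) (by linarith)
      hf hfb hf0 hfL ξ hξ
  calc ‖(Ycoord p (u ξ)).1 - ξ‖ ≤ 12 * R * (4 * R) / ‖ξ‖ := key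
    _ = 48 * R ^ 2 / ‖ξ‖ := by ring

end Summit.SmoothPoincare4.SmoothPoincare4.Theorems.WitnessCharge.PencilIncompleteness
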